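import Summits.AtomisticToContinuum.Crystallization.Theorems.HullExactificationCascadeZeroDefectDensityCoordsHcpFrame
import Literature.Geometry.DiscreteGeometry.KissingRigidity
import HarnessLib

/-!
# Coordinates for the birth line of `ZeroDefectDensity` — II: the seven good points of an hcp shell
# (route `HullExactificationCascade`, crux `ZeroDefectDensity`, stmt-AtomisticToContinuum-12086; stub `stub_coordsHcp`)

Support file (lead c4, stub-worker) for the registered stub `stub_coordsHcp`.  Twelve shell vectors
`p i` (`i : Fin 12`, the enumeration `hcpTab` of the hcp pattern of
`Literature/Geometry/DiscreteGeometry/KissingRigidity.lean`: hexagon `0–5`, upper triangle `6–8`,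
lower triangle `9–11`) have norms `1 ± 1/4000` and, for pairs of pattern type contact / `√2` / `√3`
(`|hcpTab i - hcpTab j|² = 18 / 36 / 54`), distances `1 ± 1/4000`, `|d² - 2| ≤ 38/4000`,
`|d² - 3| ≤ 40/4000`.  The frame is the explicit Gram–Schmidt frame (`…CoordsHcpFrame`,
`…AsmFrame`) of `v₁ = p 6 + p 0`, `v₂ = p 6 - p 0`, `v₃ = p 7 - p 2` (pattern directions
`(1,1,0), (1,-1,0), (1,0,±1)`, so the frame is `≈` the coordinate frame of `hcpTab / √18`).

* `hcp_good` — the frame is orthonormal, and each of the seven GOOD points `0, 2, 4, 5, 6, 7, 8`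
  (those whose four pattern types to `6, 0, 7, 2` are pinned) has frame coordinates within
  `(0.0063, 0.0068, 0.0042)` (points `0, 6`), `(0.0033, 0.0017, 0.0093)` (points `2, 7`),
  `(0.0046, 0.0071, 0.0097)` (points `4, 5, 8`) of `hcpTab i / √18`; in particular within
  Euclidean distance `0.013`.

`hcp_good_coords` is its registered one-line form. The five remaining points are treated in
`…CoordsHcpBad`. Elementary; constants checked in exact
rational arithmetic. [folklore]
-/

noncomputable section

namespace Summit.AtomisticToContinuum.Crystallization.Theorems.ZeroDefectDensityBirth

open Real RealInnerProductSpace Literature.Geometry.DiscreteGeometry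

/-- Packaging three coordinate bounds as a bound indexed by `Fin 3`. [folklore] -/
theorem hcp_coords_forall (i : Fin 12) (t₀ t₁ t₂ : ℝ) {q b₁ b₂ b₃ : EuclideanSpace ℝ (Fin 3)}
    (h0 : |⟪q, b₁⟫ - (Real.sqrt 18)⁻¹ * ((hcpTab i 0 : ℤ) : ℝ)| ≤ t₀)
    (h1 : |⟪q, b₂⟫ - (Real.sqrt 18)⁻¹ * ((hcpTab i 1 : ℤ) : ℝ)| ≤ t₁)
    (h2 : |⟪q, b₃⟫ - (Real.sqrt 18)⁻¹ * ((hcpTab i 2 : ℤ) : ℝ)| ≤ t₂) :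
    ∀ k : Fin 3, |⟪q, ![b₁, b₂, b₃] k⟫ - (Real.sqrt 18)⁻¹ * ((hcpTab i k : ℤ) : ℝ)| ≤
      (![t₀, t₁, t₂] : Fin 3 → ℝ) k := by
  intro k
  fin_cases k
  exacts [h0, h1, h2]

/-- Ideal coordinates: `K/√2 = t/√18` when `t = 3K`. [folklore] -/
theorem hcp_target_eq {K : ℝ} {t : ℤ} (n : ℤ) (ht : t = n) (h : (n : ℝ) = 3 * K) :
    K * (√2)⁻¹ = (Real.sqrt 18)⁻¹ * (t : ℝ) := by
  have hs : (0 : ℝ) < √2 := Real.sqrt_pos.2 (by norm_num)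
  rw [ht, h, hcp_sqrt_eighteen, mul_inv]
  field_simp

/-- **The seven good points of a soft hcp shell.**  See the module docstring. [folklore] -/
theorem hcp_good {p : Fin 12 → EuclideanSpace ℝ (Fin 3)} {b₁ b₂ b₃ : EuclideanSpace ℝ (Fin 3)}
    (hn : ∀ i, 1 - 1 / 4000 ≤ ‖p i‖ ∧ ‖p i‖ ≤ 1 + 1 / 4000)
    (h1 : ∀ i j, sqNormInt (hcpTab i - hcpTab j) = 18 →
      1 - 1 / 4000 ≤ ‖p i - p j‖ ∧ ‖p i - p j‖ ≤ 1 + 1 / 4000)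
    (h2 : ∀ i j, sqNormInt (hcpTab i - hcpTab j) = 36 → |‖p i - p j‖ ^ 2 - 2| ≤ 38 / 4000)
    (h3 : ∀ i j, sqNormInt (hcpTab i - hcpTab j) = 54 → |‖p i - p j‖ ^ 2 - 3| ≤ 40 / 4000)
    (hb₁ : b₁ = ‖p 6 + p 0‖⁻¹ • (p 6 + p 0))
    (hb₂ : b₂ = ‖(p 6 - p 0) - ⟪p 6 - p 0, b₁⟫ • b₁‖⁻¹ • ((p 6 - p 0) - ⟪p 6 - p 0, b₁⟫ • b₁))
    (hb₃ : b₃ = ‖(p 7 - p 2) - ⟪p 7 - p 2, b₁⟫ • b₁ - ⟪p 7 - p 2, b₂⟫ • b₂‖⁻¹ •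
      ((p 7 - p 2) - ⟪p 7 - p 2, b₁⟫ • b₁ - ⟪p 7 - p 2, b₂⟫ • b₂)) :
    Orthonormal ℝ ![b₁, b₂, b₃] ∧
    (∀ k : Fin 3, |⟪p 0, ![b₁, b₂, b₃] k⟫ - (Real.sqrt 18)⁻¹ * ((hcpTab 0 k : ℤ) : ℝ)| ≤
      (![0.0063, 0.0068, 0.0042] : Fin 3 → ℝ) k) ∧
    (∀ k : Fin 3, |⟪p 2, ![b₁, b₂, b₃] k⟫ - (Real.sqrt 18)⁻¹ * ((hcpTab 2 k : ℤ) : ℝ)| ≤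
      (![0.0033, 0.0017, 0.0093] : Fin 3 → ℝ) k) ∧
    (∀ k : Fin 3, |⟪p 4, ![b₁, b₂, b₃] k⟫ - (Real.sqrt 18)⁻¹ * ((hcpTab 4 k : ℤ) : ℝ)| ≤
      (![0.0046, 0.0071, 0.0097] : Fin 3 → ℝ) k) ∧
    (∀ k : Fin 3, |⟪p 5, ![b₁, b₂, b₃] k⟫ - (Real.sqrt 18)⁻¹ * ((hcpTab 5 k : ℤ) : ℝ)| ≤
      (![0.0046, 0.0071, 0.0097] : Fin 3 → ℝ) k) ∧
    (∀ k : Fin 3, |⟪p 6, ![b₁, b₂, b₃] k⟫ - (Real.sqrt 18)⁻¹ * ((hcpTab 6 k : ℤ) : ℝ)| ≤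
      (![0.0063, 0.0068, 0.0042] : Fin 3 → ℝ) k) ∧
    (∀ k : Fin 3, |⟪p 7, ![b₁, b₂, b₃] k⟫ - (Real.sqrt 18)⁻¹ * ((hcpTab 7 k : ℤ) : ℝ)| ≤
      (![0.0033, 0.0017, 0.0093] : Fin 3 → ℝ) k) ∧
    (∀ k : Fin 3, |⟪p 8, ![b₁, b₂, b₃] k⟫ - (Real.sqrt 18)⁻¹ * ((hcpTab 8 k : ℤ) : ℝ)| ≤
      (![0.0046, 0.0071, 0.0097] : Fin 3 → ℝ) k) := by
  -- Gram entries from the metric data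
  have e : ∀ i, |‖p i‖ ^ 2 - 1| ≤ 0.0005001 := fun i => hcp_abs_sq_sub_one_le (hn i)
  have G0 : ∀ i, |⟪p i, p i⟫ - 1| ≤ 0.0005001 := fun i => by
    rw [real_inner_self_eq_norm_sq]; exact e i
  have G1 : ∀ i j, sqNormInt (hcpTab i - hcpTab j) = 18 → |⟪p i, p j⟫ - 1 / 2| ≤ 0.00075015 :=
    fun i j h => hcp_inner_approx (e i) (e j) (hcp_abs_sq_sub_one_le (h1 i j h)) (by norm_num) (by norm_num)
  have G2 : ∀ i j, sqNormInt (hcpTab i - hcpTab j) = 36 → |⟪p i, p j⟫ - 0| ≤ 0.0052501 :=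
    fun i j h => hcp_inner_approx (e i) (e j) (h2 i j h) (by norm_num) (by norm_num)
  have G3 : ∀ i j, sqNormInt (hcpTab i - hcpTab j) = 54 → |⟪p i, p j⟫ - (-1 / 2)| ≤ 0.0055001 :=
    fun i j h => hcp_inner_approx (e i) (e j) (h3 i j h) (by norm_num) (by norm_num)
  -- the frame
  obtain ⟨hv1, hw2, hw3, ⟨hL1, hι1⟩, hκ, ⟨hL2, hι2⟩, hμ1, hμ2, ⟨hL3, hι3⟩⟩ :=
    hcp_frame_bounds (hn 6) (hn 0) (hn 7) (hn 2) (h2 6 0 (by decide)) (h2 7 2 (by decide))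
      (h1 7 6 (by decide)) (h1 7 0 (by decide)) (h1 2 6 (by decide)) (h1 2 0 (by decide))
      rfl rfl rfl hb₁ hb₂
  have hO : Orthonormal ℝ ![b₁, b₂, b₃] := gs_orthonormal hv1 hb₁ hw2 hb₂ hw3 hb₃
  have n1 : ‖b₁‖ = 1 := by
    rw [hb₁, norm_smul, norm_inv, norm_norm, inv_mul_cancel₀ (norm_ne_zero_iff.2 hv1)]
  have n2 : ‖b₂‖ = 1 := by
    rw [hb₂, norm_smul, norm_inv, norm_norm, inv_mul_cancel₀ (norm_ne_zero_iff.2 hw2)]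
  -- the generic coordinate computation, specialised to this frame
  have GC : ∀ {q : EuclideanSpace ℝ (Fin 3)} {A₀ B₀ C₀ D₀ ea eb ec ed : ℝ}, ‖q‖ ≤ 1 + 1 / 4000 →
      |⟪q, p 6⟫ - A₀| ≤ ea → |⟪q, p 0⟫ - B₀| ≤ eb → |⟪q, p 7⟫ - C₀| ≤ ec → |⟪q, p 2⟫ - D₀| ≤ ed →
      |⟪q, b₁⟫ - (A₀ + B₀) * (√2)⁻¹| ≤ (ea + eb) / 1.41 + |A₀ + B₀| * 0.00205 ∧
      |⟪q, b₂⟫ - (A₀ - B₀) * (√2)⁻¹| ≤ (ea + eb + 0.00072) / 1.41 + |A₀ - B₀| * 0.00205 ∧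
      |⟪q, b₃⟫ - (C₀ - D₀) * (√2)⁻¹| ≤ (ec + ed + 0.00427) / 1.41 + |C₀ - D₀| * 0.00205 :=
    fun hq ha hb hc hd => hcp_frame_coords hq rfl rfl rfl hb₁ hb₂ hb₃ n1 n2 hL1 hι1 hκ hL2 hι2 hμ1 hμ2
      hL3 hι3 ha hb hc hd
  -- point 0 (types to 6, 0, 7, 2: √2, itself, contact, contact)
  have c0 := GC (hn 0).2 (G2 0 6 (by decide)) (G0 0) (G1 0 7 (by decide)) (G1 0 2 (by decide))
  have P0 := hcp_coords_forall 0 0.0063 0.0068 0.0042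
    (hcp_retarget c0.1 (hcp_target_eq 3 (by decide) (by norm_num)) (by norm_num))
    (hcp_retarget c0.2.1 (hcp_target_eq (-3) (by decide) (by norm_num)) (by norm_num))
    (hcp_retarget c0.2.2 (hcp_target_eq 0 (by decide) (by norm_num)) (by norm_num))
  -- point 2 (contact, contact, √2, itself)
  have c2 := GC (hn 2).2 (G1 2 6 (by decide)) (G1 2 0 (by decide)) (G2 2 7 (by decide)) (G0 2)
  have P2 := hcp_coords_forall 2 0.0033 0.0017 0.0093
    (hcp_retarget c2.1 (hcp_target_eq 3 (by decide) (by norm_num)) (by norm_num))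
    (hcp_retarget c2.2.1 (hcp_target_eq 0 (by decide) (by norm_num)) (by norm_num))
    (hcp_retarget c2.2.2 (hcp_target_eq (-3) (by decide) (by norm_num)) (by norm_num))
  -- point 4 (contact, √3, √3, contact)
  have c4 := GC (hn 4).2 (G1 4 6 (by decide)) (G3 4 0 (by decide)) (G3 4 7 (by decide))
    (G1 4 2 (by decide))
  have P4 := hcp_coords_forall 4 0.0046 0.0071 0.0097
    (hcp_retarget c4.1 (hcp_target_eq 0 (by decide) (by norm_num)) (by norm_num))
    (hcp_retarget c4.2.1 (hcp_target_eq 3 (by decide) (by norm_num)) (by norm_num))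
    (hcp_retarget c4.2.2 (hcp_target_eq (-3) (by decide) (by norm_num)) (by norm_num))
  -- point 5 (√3, contact, contact, √3)
  have c5 := GC (hn 5).2 (G3 5 6 (by decide)) (G1 5 0 (by decide)) (G1 5 7 (by decide))
    (G3 5 2 (by decide))
  have P5 := hcp_coords_forall 5 0.0046 0.0071 0.0097
    (hcp_retarget c5.1 (hcp_target_eq 0 (by decide) (by norm_num)) (by norm_num))
    (hcp_retarget c5.2.1 (hcp_target_eq (-3) (by decide) (by norm_num)) (by norm_num))
    (hcp_retarget c5.2.2 (hcp_target_eq 3 (by decide) (by norm_num)) (by norm_num))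
  -- point 6 (itself, √2, contact, contact)
  have c6 := GC (hn 6).2 (G0 6) (G2 6 0 (by decide)) (G1 6 7 (by decide)) (G1 6 2 (by decide))
  have P6 := hcp_coords_forall 6 0.0063 0.0068 0.0042
    (hcp_retarget c6.1 (hcp_target_eq 3 (by decide) (by norm_num)) (by norm_num))
    (hcp_retarget c6.2.1 (hcp_target_eq 3 (by decide) (by norm_num)) (by norm_num))
    (hcp_retarget c6.2.2 (hcp_target_eq 0 (by decide) (by norm_num)) (by norm_num))
  -- point 7 (contact, contact, itself, √2)
  have c7 := GC (hn 7).2 (G1 7 6 (by decide)) (G1 7 0 (by decide)) (G0 7) (G2 7 2 (by decide))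
  have P7 := hcp_coords_forall 7 0.0033 0.0017 0.0093
    (hcp_retarget c7.1 (hcp_target_eq 3 (by decide) (by norm_num)) (by norm_num))
    (hcp_retarget c7.2.1 (hcp_target_eq 0 (by decide) (by norm_num)) (by norm_num))
    (hcp_retarget c7.2.2 (hcp_target_eq 3 (by decide) (by norm_num)) (by norm_num))
  -- point 8 (contact, √3, contact, √3)
  have c8 := GC (hn 8).2 (G1 8 6 (by decide)) (G3 8 0 (by decide)) (G1 8 7 (by decide))
    (G3 8 2 (by decide))
  have P8 := hcp_coords_forall 8 0.0046 0.0071 0.0097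
    (hcp_retarget c8.1 (hcp_target_eq 0 (by decide) (by norm_num)) (by norm_num))
    (hcp_retarget c8.2.1 (hcp_target_eq 3 (by decide) (by norm_num)) (by norm_num))
    (hcp_retarget c8.2.2 (hcp_target_eq 3 (by decide) (by norm_num)) (by norm_num))
  exact ⟨hO, P0, P2, P4, P5, P6, P7, P8⟩

/-- **Registered sub-goal `hcp_good_coords`** (one-line form of `hcp_good`, lead c4 stub-worker).
[folklore] -/
theorem hcp_good_coords : ∀ (p : Fin 12 → EuclideanSpace ℝ (Fin 3)) (b₁ b₂ b₃ : EuclideanSpace ℝ (Fin 3)), (∀ i, 1 - 1 / 4000 ≤ ‖p i‖ ∧ ‖p i‖ ≤ 1 + 1 / 4000) → (∀ i j, Literature.Geometry.DiscreteGeometry.sqNormInt (Literature.Geometry.DiscreteGeometry.hcpTab i - Literature.Geometry.DiscreteGeometry.hcpTab j) = 18 → 1 - 1 / 4000 ≤ ‖p i - p j‖ ∧ ‖p i - p j‖ ≤ 1 + 1 / 4000) → (∀ i j, Literature.Geometry.DiscreteGeometry.sqNormInt (Literature.Geometry.DiscreteGeometry.hcpTab i - Literature.Geometry.DiscreteGeometry.hcpTab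 j) = 36 → |‖p i - p j‖ ^ 2 - 2| ≤ 38 / 4000) → (∀ i j, Literature.Geometry.DiscreteGeometry.sqNormInt (Literature.Geometry.DiscreteGeometry.hcpTab i - Literature.Geometry.DiscreteGeometry.hcpTab j) = 54 → |‖p i - p j‖ ^ 2 - 3| ≤ 40 / 4000) → b₁ = ‖p 6 + p 0‖⁻¹ • (p 6 + p 0) → b₂ = ‖(p 6 - p 0) - inner ℝ (p 6 - p 0) b₁ • b₁‖⁻¹ • ((p 6 - p 0) - inner ℝ (p 6 - p 0) b₁ • b₁) → b₃ = ‖(p 7 - p 2) - inner ℝ (p 7 - p 2) b₁ • b₁ - inner ℝ (p 7 - p 2) b₂ • b₂‖⁻¹ • ((p 7 - p 2) - inner ℝ (p 7 - p 2) b₁ • b₁ - inner ℝ (p 7 - p 2) b₂ • b₂) → Orthonormal ℝ ![b₁, b₂, b₃] ∧ (∀ k : Fin 3, |inner ℝ (p 0) ((![b₁, b₂, b₃] : Fin 3 → EuclideanSpace ℝ (Fin 3)) k) - (Real.sqrt 18)⁻¹ * ((Literature.Geometry.DiscreteGeometry.hcpTab 0 k : ℤ) : ℝ)| ≤ (![0.0063,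 0.0068, 0.0042] : Fin 3 → ℝ) k) ∧ (∀ k : Fin 3, |inner ℝ (p 2) ((![b₁, b₂, b₃] : Fin 3 → EuclideanSpace ℝ (Fin 3)) k) - (Real.sqrt 18)⁻¹ * ((Literature.Geometry.DiscreteGeometry.hcpTab 2 k : ℤ) : ℝ)| ≤ (![0.0033, 0.0017, 0.0093] : Fin 3 → ℝ) k) ∧ (∀ k : Fin 3, |inner ℝ (p 4) ((![b₁, b₂, b₃] : Fin 3 → EuclideanSpace ℝ (Fin 3)) k) - (Real.sqrt 18)⁻¹ * ((Literature.Geometry.DiscreteGeometry.hcpTab 4 k : ℤ) : ℝ)| ≤ (![0.0046, 0.0071, 0.0097] : Fin 3 → ℝ) k) ∧ (∀ k : Fin 3, |inner ℝ (p 5) ((![b₁, b₂, b₃] : Fin 3 → EuclideanSpace ℝ (Fin 3)) k) - (Real.sqrt 18)⁻¹ * ((Literature.Geometry.DiscreteGeometry.hcpTab 5 k : ℤ) : ℝ)| ≤ (![0.0046, 0.0071, 0.0097] : Fin 3 → ℝ) k) ∧ (∀ k : Fin 3, |inner ℝ (p 6) ((![b₁, b₂, b₃] : Fin 3 → EuclideanSpace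 ℝ (Fin 3)) k) - (Real.sqrt 18)⁻¹ * ((Literature.Geometry.DiscreteGeometry.hcpTab 6 k : ℤ) : ℝ)| ≤ (![0.0063, 0.0068, 0.0042] : Fin 3 → ℝ) k) ∧ (∀ k : Fin 3, |inner ℝ (p 7) ((![b₁, b₂, b₃] : Fin 3 → EuclideanSpace ℝ (Fin 3)) k) - (Real.sqrt 18)⁻¹ * ((Literature.Geometry.DiscreteGeometry.hcpTab 7 k : ℤ) : ℝ)| ≤ (![0.0033, 0.0017, 0.0093] : Fin 3 → ℝ) k) ∧ (∀ k : Fin 3, |inner ℝ (p 8) ((![b₁, b₂, b₃] : Fin 3 → EuclideanSpace ℝ (Fin 3)) k) - (Real.sqrt 18)⁻¹ * ((Literature.Geometry.DiscreteGeometry.hcpTab 8 k : ℤ) : ℝ)| ≤ (![0.0046, 0.0071, 0.0097] : Fin 3 → ℝ) k) :=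
  fun _ _ _ _ hn h1 h2 h3 hb₁ hb₂ hb₃ => hcp_good hn h1 h2 h3 hb₁ hb₂ hb₃

end Summit.AtomisticToContinuum.Crystallization.Theorems.ZeroDefectDensityBirth

end
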